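import Summits.NavierStokesRegularity.NavierStokesRegularity.Theses.AxisymmetricExtremality
import Literature.Analysis.FluidPDE.KatoViscosityScaling
import Literature.Analysis.FluidPDE.MildSolutionsProofs
import Literature.Analysis.FluidPDE.AxisymmetricVorticityTransport
import Literature.Analysis.FluidPDE.HomSobolevRepresentedL3
import Literature.Analysis.FluidPDE.KatoGlobalSmallHolds
import Literature.Analysis.FunctionSpaces.FourierSobolevNormProofs
import Mathlib.Analysis.Distribution.Sobolev

/-!
# Disproof of `AxisymmetricKatoGlobal` — findings (cdisprove, cycle 1, 2026-08-17)

Crux item stmt-NavierStokesRegularity-15453, route `AxisymmetricExtremality`, decl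
`Summit.NavierStokesRegularity.NavierStokesRegularity.Theses.AxisymmetricExtremality.AxisymmetricKatoGlobal`:
for every `ν > 0`, every `u₀ ∈ L³(ℝ³)` represented by some `g ∈ Ḣ^{1/2}(ℝ³; ℂ³)`, weakly
divergence free and axisymmetric about the `x 2`-axis (rotation-equivariance written out; it is
`IsAxisymmetric u₀` by `Iff.rfl`, § 0) has a global Kato solution `u ∈ C([0,∞); L³)`.

## Index of findings

* § 0 READING.  The crux elaborates (rc 0); its written-out symmetry clause is definitionally
  `IsAxisymmetric u₀` (`crux_iff_isAxisymmetric_form`).  Definitions audited symbol by symbol: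
  `HasGlobalKatoSolution` (= `IsGlobalMildSolution ν 0 u₀ u ∧ ContinuousInLpOn (Ici 0) 3 u ∧
  u 0 = u₀ ∧ measurable`), `IsMildNSSolutionOn` (weakly div-free slices + Fabes–Jones–Rivière
  duality identity against `C_c^∞` DIVERGENCE-FREE tests, pressure-free — the right class),
  `heatFlow`/`heatTest` (junk only for `τ < 0` / `ν ≤ 0`, excluded by `0 < ν` and `t ≥ 0`),
  `HomSobolev.Represents` (honest Schwartz pairing, forces `u₀ ∈ L¹_loc` and a.e.-determines it),
  `IsWeaklyDivFree` (scalar `C_c^∞` tests).  NO JUNK LOOPHOLE FOUND: the zero datum has the zero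
  solution; modifications of `u₀` on null sets are absorbed by the free choice `u 0 := u₀`; the
  pointwise symmetry clause on the axis only forces `u₀ ∥ e_z` there (consistent).
* § 1 NECESSITY / REDUNDANCY (tightness of the hypothesis list).
  `isWeaklyDivFree_of_hasGlobalKatoSolution`, `memLp_three_of_hasGlobalKatoSolution`: the
  conclusion OUTPUTS `IsWeaklyDivFree u₀` and `MemLp u₀ 3` (through `u 0 = u₀`), so these two
  hypotheses are necessary and free; `memLp_three_of_represents`: `MemLp u₀ 3` is moreover
  IMPLIED by `g.Represents (complexify ∘ u₀)` (tree `HomSobolev.Represents.memLp_three`, the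
  Sobolev embedding) — h₁ is redundant, information for the prover.  NON-VACUITY of the
  conclusion predicate: `crux_small_data_instance` — for `‖u₀‖_{L³} ≤ δν` the formal
  `HasGlobalKatoSolution ν u₀` HOLDS (tree-discharged `kato_global_small_holds`, Kato 1984
  Thm. 4), so the duality-form predicate has genuine non-zero inhabitants and the crux is exactly
  the large-data question (no hidden unsatisfiability in `IsMildNSSolutionOn`).
* § 2 LOAD-BEARING HYPOTHESIS, proved: `axisymmetricKatoGlobal_false_without_divFree` —
  the crux with `IsWeaklyDivFree u₀` deleted is FALSE (witness `u₀ = ∇b`, `b(x) = S(2 − ‖x‖²)`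
  a radial bump: smooth, compactly supported, `Ḣ^{1/2}`-represented, axisymmetric, not weakly
  divergence free).  LANDED: `Theorems/AxisymmetricKatoGlobal/Negative/AxisymmetricKatoGlobalFalseWithoutDivFree.lean`
  (p153749, ACCEPTED 2026-08-17; reproduced verbatim in § 2 so this file is self-contained).  § 1 ter: WLOG `ν = 1` (`crux_iff_nu_one`).
* § 3 HYPOTHESES THAT CANNOT BE DROPPED BUT ADMIT NO NEGATIVE LEMMA HERE (prose, with reasons):
  `0 < ν` (at `ν ≤ 0` the duality identity degenerates to weak EULER in `C_t L³` — non-existence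
  for a given datum is not provable); `Represents` (dropping it = Kato's `L³` problem in the
  axisymmetric class, open); axisymmetry (dropping it = `ρ_max^pure = ⊤`, i.e. critical-space
  global regularity, open — ¬Clay territory).  A kill of the crux itself needs a certified
  finite-time singularity of axisymmetric Navier–Stokes WITH swirl from critical data: the only
  candidate in print is Hou's interior two-scale scenario (arXiv:2107.06509; sequel
  arXiv:2405.10916 needs dimension parameter `n ≳ 3.19` or degenerate viscosity) — numerical, not
  a theorem; Type I and (discretely) self-similar mechanisms are EXCLUDED in the class
  (`knss_no_axisymmetric_typeI`, barrier `AxisymmetricTypeIExclusion`; NRŠ/Tsai), so a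
  counterexample must be Type II and non-self-similar.  Verdict for this cycle: the crux is the
  axisymmetric-with-swirl regularity problem (open since Ladyzhenskaya 1968 / UY 1968) stated in
  the critical class; it resists every cheap attack because no formal slack was found (§ 0–1).
* § 4 LINE `registered` (lead c1; stubs 1, K, 2b', 2c' LANDED; open: 2a = named fact
  `seregin2022_logSwirl_regularAtOrigin`, 3 = `stub_swirlAxisModulus`).  LOAD-BEARING
  HYPOTHESIS OF STUB 3, proved and proposed (p154820,
  `Theorems/AxisymmetricKatoGlobal/Negative/SwirlAxisModulusFalseWithoutSmooth.lean`):
  `¬ SwirlAxisModulusWithoutSmooth` — stub 3 with exactly the clause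
  `ContDiffOn ℝ ⊤ (uncurry u) (Ioo 0 T ×ˢ univ) →` deleted is FALSE, because `IsKatoSolutionOn`
  pins the slices `u t`, `t > 0`, only up to spatial null sets (duality identity, `C_t L³`,
  measurability are integral / a.e. clauses; only `u 0 = u₀` is pointwise) and pointwise
  axisymmetry survives modification on rotation-invariant null sets, while the modulus is
  POINTWISE: witness `ν = T = 1`, `u₀ = 0`, `g = 0`, `u t = 0` for `t ≠ 1/2` and
  `u (1/2) x = c(‖x‖) • (−x₁, x₀, 0)` supported on `⋃ₙ sphere 0 2⁻ⁿ` with swirl `2ⁿ` at `2⁻ⁿ e₀`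
  (`> 8 max C 0 ≥ C / |log 2⁻ⁿ|³`).  Moral for the lead: smoothness is used essentially, if
  only for a.e. → pointwise; an `essSup`/a.e. modulus would be the smoothness-free form.  Checked degenerate
  cases of the two open signatures (`stub3_axis_case_no_junk`, `stub2a_log_weight_pos`): on the
  axis the bound `C / |log r|³` is Lean-junk `0` but the swirl vanishes there, so no kill; for
  `0 < r < 1` the Seregin weight `log (e / r) ≥ 1` is honest.  `stub_swirlAxisModulus` is, given
  the landed stubs, EQUIVALENT to the crux (the lead's own residue note; a global Kato solution is
  bounded on `[t₀, T] × ℝ³`, and `r |log r|³ → 0`), so it inherits § 3: no kill short of a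
  blow-up theorem.  Its `0 < t₀` is load-bearing (with `t₀ = 0` the datum slice of an `L³` datum
  with sparse swirl spikes `Γ ≈ n / |log r_n|³` on thin tori violates every fixed `C`; not
  formalised — it needs `kato_local` for a series datum — recorded for the lead, do not weaken
  `t₀`).  Stub 2a is essSup-robust (`IsRegularAtOrigin` is an `L^∞(Q(r))` statement and every
  hypothesis class is an integral class), so the "bad null slice" trick does not bite; what
  was left was PRINT-FAITHFULNESS, checked this cycle on the materialised text (arXiv:2201.00153,
  pp. 3–8): Thm 1.2's own hypotheses are (sca1) `f(R)+M(R) ≤ c_* ln^α ln^{1/2}(1/R)` and (sca2)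
  `α ≤ 1/224`; Step 1 replaces them (via Prop. 1.3 of [Seregin2021]) by the swirl modulus
  (sigmaest) ⇒ (2.2) `|σ| ≤ cC₁/ln³(e/r)`, and Steps 2–4 (Lemma 2.1, the localised `Φ = ω_r/r`,
  `Γ = ω_θ/r` energy scheme with the 2-D Leray inequality Lemma 2.2, the choice of `r₁` with
  `cC₁/ln(e/r₁) + cC₁²/ln⁴(e/r₁) < 2` — possible for EVERY `C₁` —, and the `C(R) → 0`
  conclusion) use only Def. 1.1, axial symmetry of `v, q`, CKN partial regularity and (2.2).
  So the tree fact (hypothesis = (2.2) with an arbitrary real `C₁`) is the statement the printed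
  §2 proves — CONFIRMED faithful; the one soft spot a grounder should note is the usual tacit
  "up to the first singular time inside `supp η`" justification of the Step-3 energy identities
  for a suitable weak (not a priori smooth) solution, a discharge issue, not a refutation.
* § 5 BARRIERS.  `EnergySupercriticality` bites on the crux and on stub 3 (any proof uses
  structure beyond energy + maximum principle: here the swirl `Γ`); `AxisymmetricTypeIExclusion`
  is consistent (it is an ingredient, not an obstruction); `TaoAveragedBlowup` does not transfer
  (no `SO(2)`-equivariant averaged model with swirl maximum principle is known);
  `CriticalDataSmoothNonuniqueness` n/a (Kato solutions are unique, `kato_unique_holds`).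

Everything below is sorry-free and kernel-checked (`lean check` rc 0 at publication).
-/

set_option linter.dupNamespace false
set_option linter.unusedVariables false

noncomputable section

open MeasureTheory Set Function Filter Topology
open Literature.Analysis.FluidPDE Literature.Analysis.FunctionSpaces
open Literature.Analysis.FunctionSpaces.EuclideanSpace (complexify contDiff_complexify_comp_iff)
open scoped ENNReal NNReal SchwartzMap RealInnerProductSpace

namespace Summit.NavierStokesRegularity.NavierStokesRegularity.Cruxes.AxisymmetricKatoGlobal.Disproof

local notation "ℝ³" => EuclideanSpace ℝ (Fin 3)
local notation "ℂ³" => EuclideanSpace ℂ (Fin 3)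

/-! ## § 0 Reading of the crux -/

/-- The crux's written-out symmetry clause is `IsAxisymmetric u₀` definitionally, so the crux
is literally: `∀ ν > 0, ∀ u₀ g, MemLp u₀ 3 → g.Represents (complexify ∘ u₀) → IsWeaklyDivFree u₀ →
IsAxisymmetric u₀ → HasGlobalKatoSolution ν u₀`. [folklore] -/
theorem crux_iff_isAxisymmetric_form :
    Theses.AxisymmetricExtremality.AxisymmetricKatoGlobal ↔
      ∀ ν : ℝ, 0 < ν → ∀ (u₀ : ℝ³ → ℝ³) (g : HomSobolev ℝ³ ℂ³ (1 / 2 : ℝ)),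
        MemLp u₀ 3 volume → g.Represents (complexify ∘ u₀) → IsWeaklyDivFree u₀ →
        IsAxisymmetric u₀ → HasGlobalKatoSolution ν u₀ :=
  Iff.rfl

/-! ## § 1 Necessity and redundancy of hypotheses -/

/-- `MemLp u₀ 3` is implied by the representation hypothesis (Sobolev embedding
`Ḣ^{1/2}(ℝ³) ⊂ L³`, tree `HomSobolev.Represents.memLp_three` + `memLp_complexify_comp_iff`):
hypothesis h₁ of the crux is redundant given h₂. [folklore] -/
theorem memLp_three_of_represents {u₀ : ℝ³ → ℝ³} {g : HomSobolev ℝ³ ℂ³ (1 / 2 : ℝ)}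
    (h : g.Represents (complexify ∘ u₀)) : MemLp u₀ 3 volume :=
  memLp_complexify_comp_iff.1 h.memLp_three




/-- Necessity of `IsWeaklyDivFree u₀` (LANDED, p153749:
`Theorems.AxisymmetricKatoGlobal.Negative.isWeaklyDivFree_of_hasGlobalKatoSolution`): the
conclusion outputs it through `u 0 = u₀`. [folklore] -/
theorem isWeaklyDivFree_of_hasGlobalKatoSolution {ν : ℝ} {u₀ : ℝ³ → ℝ³}
    (h : HasGlobalKatoSolution ν u₀) : IsWeaklyDivFree u₀ := by
  obtain ⟨u, hmild, -, h0, -⟩ := h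
  subst h0
  exact hmild.1 0 (mem_Ici.2 le_rfl)

/-- Necessity of `MemLp u₀ 3` (LANDED, p153749:
`Theorems.AxisymmetricKatoGlobal.Negative.memLp_three_of_hasGlobalKatoSolution`). [folklore] -/
theorem memLp_three_of_hasGlobalKatoSolution {ν : ℝ} {u₀ : ℝ³ → ℝ³}
    (h : HasGlobalKatoSolution ν u₀) : MemLp u₀ 3 volume := by
  obtain ⟨u, -, hcont, h0, -⟩ := h
  subst h0
  exact hcont.1 0 (mem_Ici.2 le_rfl)

/-! ## § 1 ter Normalisation: the crux is its own `ν = 1` instance -/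

/-- **WLOG `ν = 1`.**  The crux is equivalent to its unit-viscosity instance: for `ν > 0` the
datum `ν⁻¹ • u₀` is again `L³`, represented (by `(ν⁻¹ : ℂ) • g`, `represents_complexify_smul`),
weakly divergence free and axisymmetric, and `HasGlobalKatoSolution 1 (ν⁻¹ • u₀) ↔
HasGlobalKatoSolution ν u₀` (`hasGlobalKatoSolution_smul_iff`, the scaling `u ↦ ν⁻¹u(ν⁻¹t)`;
Rusin–Šverák 2011, §1).  Information for provers (all stubs of line `registered` are already
stated for general `ν`). [cite: RusinSverak2011, §1 (normalisation ν = 1 by scaling)] -/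
theorem crux_iff_nu_one :
    Theses.AxisymmetricExtremality.AxisymmetricKatoGlobal ↔
      ∀ (u₀ : ℝ³ → ℝ³) (g : HomSobolev ℝ³ ℂ³ (1 / 2 : ℝ)),
        MemLp u₀ 3 volume → g.Represents (complexify ∘ u₀) → IsWeaklyDivFree u₀ →
        IsAxisymmetric u₀ → HasGlobalKatoSolution 1 u₀ := by
  rw [crux_iff_isAxisymmetric_form]
  refine ⟨fun h u₀ g h3 hrep hdiv hax => h 1 one_pos u₀ g h3 hrep hdiv hax, fun h ν hν u₀ g h3 hrep hdiv hax => ?_⟩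
  have hν' : 0 < ν⁻¹ := inv_pos.2 hν
  have hax' : IsAxisymmetric (ν⁻¹ • u₀) := fun θ x => by
    simp only [Pi.smul_apply, hax θ x]
    exact ((rotZL θ).map_smul ν⁻¹ (u₀ x)).symm
  have h1 : HasGlobalKatoSolution 1 (ν⁻¹ • u₀) :=
    h (ν⁻¹ • u₀) _ (h3.const_smul ν⁻¹) (represents_complexify_smul hrep ν⁻¹)
      (hdiv.const_smul ν⁻¹) hax'
  have h2 := (hasGlobalKatoSolution_smul_iff (ν := 1) (u₀ := ν⁻¹ • u₀) hν).2 h1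
  rwa [smul_inv_smul₀ hν.ne', mul_one] at h2

/-! ## § 2 Load-bearing hypothesis: the crux without `IsWeaklyDivFree u₀` is false (LANDED) -/

/-! The block below is, verbatim, the LANDED tree file
`Theorems/AxisymmetricKatoGlobal/Negative/AxisymmetricKatoGlobalFalseWithoutDivFree.lean`
(p153749, ACCEPTED; namespace `…Theorems.AxisymmetricKatoGlobal.Negative`), kept self-contained
here so that this work file elaborates independently of the farm's build state of that module;
ideators/planners should IMPORT the tree module, not this file. -/

/-- `AxisymmetricKatoGlobal` with the hypothesis `IsWeaklyDivFree u₀` deleted (everything else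
verbatim, axisymmetry written out as in the route file). -/
def AxisymmetricKatoGlobalWithoutDivFree : Prop :=
  ∀ ν : ℝ, 0 < ν → ∀ (u₀ : ℝ³ → ℝ³) (g : HomSobolev ℝ³ ℂ³ (1 / 2 : ℝ)),
    MemLp u₀ 3 volume → g.Represents (complexify ∘ u₀) →
    (∀ (θ : ℝ) (x : ℝ³), u₀ (WithLp.toLp 2 ![Real.cos θ * x 0 - Real.sin θ * x 1,
        Real.sin θ * x 0 + Real.cos θ * x 1, x 2]) =
      WithLp.toLp 2 ![Real.cos θ * u₀ x 0 - Real.sin θ * u₀ x 1,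
        Real.sin θ * u₀ x 0 + Real.cos θ * u₀ x 1, u₀ x 2]) →
    HasGlobalKatoSolution ν u₀

/-! ### The witness: the gradient of a radial bump -/

/-- The radial bump `b(x) = S(2 − ‖x‖²)`, `S` Mathlib's `Real.smoothTransition`: smooth, `= 1` on
the unit ball, `= 0` off the ball of radius `√2`. [folklore] -/
def radBump (x : ℝ³) : ℝ := Real.smoothTransition (2 - ‖x‖ ^ 2)

/-- `b` is smooth. [folklore] -/
theorem radBump_contDiff : ContDiff ℝ (⊤ : ℕ∞) radBump :=
  Real.smoothTransition.contDiff.comp (contDiff_const.sub (contDiff_norm_sq ℝ))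

/-- `b` is differentiable. [folklore] -/
theorem radBump_differentiable : Differentiable ℝ radBump :=
  radBump_contDiff.differentiable (by simp)

/-- `b = 0` where `‖x‖² ≥ 2`. [folklore] -/
theorem radBump_eq_zero {x : ℝ³} (hx : 2 ≤ ‖x‖ ^ 2) : radBump x = 0 :=
  Real.smoothTransition.zero_of_nonpos (by linarith)

/-- `b` is supported in the closed ball of radius `2`. [folklore] -/
theorem radBump_hasCompactSupport : HasCompactSupport radBump := by
  refine HasCompactSupport.intro (isCompact_closedBall (0 : ℝ³) 2) fun x hx => ?_
  apply radBump_eq_zero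
  rw [Metric.mem_closedBall, dist_zero_right, not_le] at hx
  nlinarith [norm_nonneg x]

/-- `b` is radial, in particular invariant under the rotations about the axis. [folklore] -/
theorem radBump_rotZ (θ : ℝ) (x : ℝ³) : radBump (rotZ θ x) = radBump x := by
  simp only [radBump, norm_rotZ]

/-- `b 0 = 1`. [folklore] -/
theorem radBump_zero : radBump 0 = 1 := by
  simp only [radBump, norm_zero]
  exact Real.smoothTransition.one_of_one_le (by norm_num)

/-- `b` vanishes at the point `2 e₀`. [folklore] -/
theorem radBump_two_single : radBump (EuclideanSpace.single (0 : Fin 3) (2 : ℝ)) = 0 := by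
  apply radBump_eq_zero
  norm_num [EuclideanSpace.norm_sq_eq, Fin.sum_univ_three]

/-- The witness datum: the gradient field `u₀ = ∇b`. [folklore] -/
def gradDatum (x : ℝ³) : ℝ³ := gradient radBump x

/-- `∇b = (toDual)⁻¹ ∘ Db`. [folklore] -/
theorem gradDatum_eq : gradDatum = (InnerProductSpace.toDual ℝ ℝ³).symm ∘ fderiv ℝ radBump := rfl

/-- The witness is smooth. [folklore] -/
theorem gradDatum_contDiff : ContDiff ℝ (⊤ : ℕ∞) gradDatum := by
  rw [gradDatum_eq]
  exact (InnerProductSpace.toDual ℝ ℝ³).symm.contDiff.comp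
    (radBump_contDiff.fderiv_right (by norm_cast))

/-- The witness is compactly supported. [folklore] -/
theorem gradDatum_hasCompactSupport : HasCompactSupport gradDatum := by
  rw [gradDatum_eq]
  exact (radBump_hasCompactSupport.fderiv (𝕜 := ℝ)).comp_left (map_zero _)

/-- The witness is an `L³` field. [folklore] -/
theorem gradDatum_memLp_three : MemLp gradDatum 3 (volume : Measure ℝ³) :=
  gradDatum_contDiff.continuous.memLp_of_hasCompactSupport gradDatum_hasCompactSupport

/-- Schwartz maps lie in `Ḣ^s ∩ L²` for `s ≥ 0` (Mathlib `SchwartzMap.memSobolev` + the tree's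
bridge `memSobolev_two_iff_eFourierSobolevNorm_lt_top_holds` + `H^s ⊆ Ḣ^s ∩ L²`,
`MemFourierSobolev.memHomSobolev_holds`; Bahouri–Chemin–Danchin 2011, §1.4.1).  Private copy of
the argument of `thresholdFinite_memHomSobolev_schwartz`
(`Theorems/AxisymmetricExtremalityMinimalDatumPFoldThresholdFinite.lean`, itself private). [folklore] -/
private theorem memHomSobolev_schwartz {E F : Type*} [NormedAddCommGroup E]
    [InnerProductSpace ℝ E] [FiniteDimensional ℝ E] [MeasurableSpace E] [BorelSpace E]
    [NormedAddCommGroup F] [InnerProductSpace ℂ F] [CompleteSpace F] {s : ℝ} (hs : 0 ≤ s)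
    (f : 𝓢(E, F)) : MemHomSobolev s (⇑f) := by
  have hB : TemperedDistribution.MemSobolev s 2
      ((f.toLp 2 (volume : Measure E) : Lp F 2 (volume : Measure E)) : 𝓢'(E, F)) := by
    rw [Lp.toTemperedDistribution_toLp_eq]
    exact f.memSobolev
  have h := memSobolev_two_iff_eFourierSobolevNorm_lt_top_holds (E := E) (F := F)
  exact MemFourierSobolev.memHomSobolev_holds hs ⟨f.memLp 2 volume, (h s _).1 hB⟩

/-- The complexified witness lies in `Ḣ^{1/2} ∩ L²` (it is a compactly supported smooth map,
hence Schwartz). [folklore] -/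
theorem gradDatum_memHomSobolev : MemHomSobolev (1 / 2 : ℝ) (complexify ∘ gradDatum) := by
  have hs : ContDiff ℝ (⊤ : ℕ∞) (complexify ∘ gradDatum) := contDiff_complexify_comp_iff.2 gradDatum_contDiff
  have hc : HasCompactSupport (complexify ∘ gradDatum) :=
    gradDatum_hasCompactSupport.comp_left (map_zero _)
  exact memHomSobolev_schwartz (by norm_num) (hc.toSchwartzMap hs)

/-- The complexified witness is represented by its own class `ofFun _ ∈ Ḣ^{1/2}`
(`HomSobolev.represents_ofFun_holds`). [folklore] -/
theorem gradDatum_represents :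
    (HomSobolev.ofFun (complexify ∘ gradDatum) gradDatum_memHomSobolev).Represents (complexify ∘ gradDatum) :=
  HomSobolev.represents_ofFun_holds (by rw [finrank_euclideanSpace_fin]; norm_num) _ _

/-- Chain rule for the radial bump: `Db(R_θ x)[R_θ v] = Db(x)[v]`. [folklore] -/
theorem fderiv_radBump_rotZ (θ : ℝ) (x v : ℝ³) :
    fderiv ℝ radBump (rotZ θ x) (rotZ θ v) = fderiv ℝ radBump x v := by
  have hcomp : (fun y => radBump (rotZL θ y)) = radBump := funext fun y => radBump_rotZ θ y
  have hl : HasFDerivAt (fun y => radBump (rotZL θ y)) ((fderiv ℝ radBump (rotZ θ x)).comp (rotZL θ)) x :=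
    (radBump_differentiable (rotZL θ x)).hasFDerivAt.comp x (rotZL θ).hasFDerivAt
  rw [hcomp] at hl
  rw [hl.fderiv, ContinuousLinearMap.comp_apply, rotZL_apply]

/-- **The witness is axisymmetric**: `∇b (R_θ x) = R_θ (∇b x)` (a radial scalar has a
rotation-equivariant gradient). [folklore] -/
theorem gradDatum_rotZ (θ : ℝ) (x : ℝ³) : gradDatum (rotZ θ x) = rotZ θ (gradDatum x) := by
  have hw : ∀ w : ℝ³, rotZ θ (rotZ (-θ) w) = w := fun w => by
    rw [← rotZ_add, add_neg_cancel, rotZ_zero]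
  refine ext_inner_right ℝ fun w => ?_
  conv_rhs => rw [← hw w, gradDatum, ← rotZLIE_apply θ (gradient radBump x),
    ← rotZLIE_apply θ (rotZ (-θ) w), LinearIsometryEquiv.inner_map_map]
  conv_lhs => rw [← hw w, gradDatum]
  simp only [gradient, InnerProductSpace.toDual_symm_apply, fderiv_radBump_rotZ]

/-- The written-out form of axisymmetry used by the route file. [folklore] -/
theorem gradDatum_rotZ' (θ : ℝ) (x : ℝ³) :
    gradDatum (WithLp.toLp 2 ![Real.cos θ * x 0 - Real.sin θ * x 1,
        Real.sin θ * x 0 + Real.cos θ * x 1, x 2]) =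
      WithLp.toLp 2 ![Real.cos θ * gradDatum x 0 - Real.sin θ * gradDatum x 1,
        Real.sin θ * gradDatum x 0 + Real.cos θ * gradDatum x 1, gradDatum x 2] :=
  gradDatum_rotZ θ x

/-- **The witness is not weakly divergence free**: tested against `b` itself,
`∫ ⟪∇b, ∇b⟫ = ∫ ‖∇b‖² > 0`, since `∇b` is continuous and not identically zero (`b(0) = 1`,
`b(2e₀) = 0`). [folklore] -/
theorem gradDatum_not_isWeaklyDivFree : ¬ IsWeaklyDivFree gradDatum := by
  intro h
  have htest : IsTestFunctionOn (⊤ : TopologicalSpace.Opens ℝ³) radBump :=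
    ⟨radBump_contDiff, radBump_hasCompactSupport, fun _ _ => trivial⟩
  have h0 : ∫ x, ⟪gradDatum x, gradient radBump x⟫ = 0 := h radBump htest
  have hcont : Continuous fun x => ⟪gradDatum x, gradient radBump x⟫ :=
    gradDatum_contDiff.continuous.inner gradDatum_contDiff.continuous
  have hcs : HasCompactSupport fun x => ⟪gradDatum x, gradient radBump x⟫ :=
    gradDatum_hasCompactSupport.mono fun x hx => by
      rw [Function.mem_support] at hx ⊢
      contrapose! hx
      rw [hx, inner_zero_left]
  have hint : Integrable (fun x => ⟪gradDatum x, gradient radBump x⟫) volume :=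
    hcont.integrable_of_hasCompactSupport hcs
  have hnn : 0 ≤ fun x => ⟪gradDatum x, gradient radBump x⟫ := fun x => real_inner_self_nonneg
  have hne : (Function.support fun x => ⟪gradDatum x, gradient radBump x⟫).Nonempty := by
    by_contra hemp
    rw [Set.not_nonempty_iff_eq_empty, Function.support_eq_empty_iff] at hemp
    have hzero : ∀ y, fderiv ℝ radBump y = 0 := fun y => by
      have hy := congr_fun hemp y
      simp only [Pi.zero_apply, gradDatum, inner_self_eq_zero] at hy
      rw [← toDual_gradient, hy, map_zero]
    have hc := is_const_of_fderiv_eq_zero radBump_differentiable hzero 0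
      (EuclideanSpace.single (0 : Fin 3) (2 : ℝ))
    rw [radBump_zero, radBump_two_single] at hc
    exact one_ne_zero hc
  have hpos : 0 < ∫ x, ⟪gradDatum x, gradient radBump x⟫ :=
    (integral_pos_iff_support_of_nonneg hnn hint).2 (hcont.isOpen_support.measure_pos volume hne)
  exact hpos.ne' h0

/-! ### The negative lemma -/

/-- **Any proof of the crux must use `IsWeaklyDivFree u₀`.**  The crux with that hypothesis
deleted is false: the gradient datum `∇b` (smooth, compactly supported, hence `L³` and
`Ḣ^{1/2}`-represented; axisymmetric) would have a global Kato solution at `ν = 1`, whose slice at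
`t = 0` is `∇b` itself and is weakly divergence free — but `∇b` is not. [folklore] -/
theorem axisymmetricKatoGlobal_false_without_divFree : ¬ AxisymmetricKatoGlobalWithoutDivFree := by
  intro h
  have hK : HasGlobalKatoSolution 1 gradDatum :=
    h 1 one_pos gradDatum _ gradDatum_memLp_three gradDatum_represents gradDatum_rotZ'
  exact gradDatum_not_isWeaklyDivFree (isWeaklyDivFree_of_hasGlobalKatoSolution hK)

/-- The witness has no global Kato solution at any viscosity (corollary of § 1 + the witness's
failure of weak divergence-freeness). [folklore] -/
theorem gradDatum_not_hasGlobalKatoSolution (ν : ℝ) :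
    ¬ HasGlobalKatoSolution ν gradDatum := fun h =>
  gradDatum_not_isWeaklyDivFree (isWeaklyDivFree_of_hasGlobalKatoSolution h)

/-! ## § 1 bis Non-vacuity: the small-data instance of the crux holds in the tree -/

/-- **The conclusion predicate is genuinely inhabited (small data).**  For every `ν > 0` and
every weakly divergence-free `u₀ ∈ L³` with `‖u₀‖_{L³} ≤ δν` the formal conclusion
`HasGlobalKatoSolution ν u₀` holds — the tree's DISCHARGED `kato_global_small_holds`
(Kato 1984, Thms. 2–4).  Hence the duality-form predicate `IsGlobalMildSolution` carries no
hidden unsatisfiability, and the crux is exactly the large-data (equivalently, by the scaling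
`u ↦ ν⁻¹u(ν⁻¹t)`, the `ν = 1` large-data) axisymmetric problem. [cite: Kato1984MathZ, Thms. 2–4] -/
theorem crux_small_data_instance :
    ∃ δ : ℝ, 0 < δ ∧ ∀ ν : ℝ, 0 < ν → ∀ u₀ : ℝ³ → ℝ³, MemLp u₀ 3 volume → IsWeaklyDivFree u₀ →
      eLpNorm u₀ 3 volume ≤ ENNReal.ofReal (δ * ν) → HasGlobalKatoSolution ν u₀ := by
  obtain ⟨δ, hδ, h⟩ := kato_global_small_holds
  refine ⟨δ, hδ, fun ν hν u₀ h3 hdiv hsmall => ?_⟩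
  obtain ⟨u, hg, hc, h0, hm, -, -⟩ := h ν hν u₀ h3 hdiv hsmall
  exact ⟨u, hg, hc, h0, hm⟩

/-! ## § 4 Line `registered`: degenerate cases of the open stub signatures -/

/-- Stub 3 (`stub_swirlAxisModulus`) on the axis: the bound `C / |log (cylRadius x)|³` is the
Lean-junk value `C / 0 = 0` at `cylRadius x = 0` (`Real.log 0 = 0`), but the swirl
`Γ = x₀u₁ − x₁u₀` vanishes there, so the degenerate instance HOLDS — no junk kill. [folklore] -/
theorem stub3_axis_case_no_junk (u : ℝ³ → ℝ³) (x : ℝ³) (hx : cylRadius x = 0) (C : ℝ) :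
    |swirl u x| ≤ C / |Real.log (cylRadius x)| ^ 3 := by
  rw [swirl_eq_zero_of_cylRadius_eq_zero u hx, hx, Real.log_zero]
  simp

/-- Stub 2a (`stub_sereginLogSwirlOrigin` = fact `seregin2022_logSwirl_regularAtOrigin`): the
weight `log (e / r)` of its swirl hypothesis is `≥ 1` for `0 < r ≤ 1`, so `C₁ / log (e/r)³` is an
honest (junk-free) bound in the unit cylinder. [folklore] -/
theorem stub2a_log_weight_pos {r : ℝ} (hr : 0 < r) (hr1 : r ≤ 1) :
    1 ≤ Real.log (Real.exp 1 / r) := by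
  rw [Real.log_div (Real.exp_pos 1).ne' hr.ne', Real.log_exp]
  linarith [Real.log_nonpos hr.le hr1]

end Summit.NavierStokesRegularity.NavierStokesRegularity.Cruxes.AxisymmetricKatoGlobal.Disproof

end
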